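import Literature.Computability.Complexity.PolyExistsNTIMEClock
import HarnessLib

/-!
# The root clock `t ↦ ⟨t, 1^{c' · 2^{⌊|t|^{1/r'}⌋} + c' + 1}⟩` as a timed stack program

Machine-level toolkit for the guess-and-verify closure of `NSUBEXP = ⋂_{r>0} NTIME(2^{⌊n^{1/r}⌋})`
(`NSubexp.lean`) under polynomially many guarded sub-queries (`NSUBEXPGuardedBall.lean`, serving
Kabanets–Impagliazzo 2003, Lemma 3: `Perm ∈ NSUBEXP ⟹ P^{Perm} ⊆ NSUBEXP`). A presentation
`(c', R', M')` of a language `A ∈ NTIME(2^{⌊m^{1/r'}⌋})` in the tree's one-constant verifier form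
(`Nondeterministic.lean`) specifies the machine `M'` only on pairs `⟨t, z⟩` with
`|z| ≤ c' · 2^{⌊|t|^{1/r'}⌋} + c'`; a verifier that receives a longer `z` must therefore cut it at
EXACTLY that length before running `M'`, which the tree's truncating wrapper `truncMapAux N`
(`TruncMapMachine.lean`) does when fed the clock `N : t ↦ ⟨t, 1^{c' · 2^{⌊|t|^{1/r'}⌋} + c' + 1}⟩`
(one extra symbol for a flag bit travelling in front of `z`). This file programs that clock as a
structured stack program over the register file of `PolyExistsNTIMEPrograms.lean`, reusing its
verified routines (`split`, `rootLoop`, `dblE`, `emitX`):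

* `rootClockLen r' c' m = c' · 2^{⌊m^{1/r'}⌋} + c' + 1`, `rootClock r' c' t = ⟨t, 1^{rootClockLen r' c' |t|}⟩`;
* `RootClock.prog r' c'`, `RootClock.runs_prog` (exact cost `RootClock.cost r' c' |t|`);
* `RootClock.exists_cost_le`: `cost r' c' n + 1 ≤ P(n) + K · 2^{⌊n^{1/r'}⌋}` for a polynomial `P`
  and a constant `K`;
* **`exists_rootClock_machine`**: a `TM2` machine computing `rootClock r' c'` within
  `P(|t|) + K · 2^{⌊|t|^{1/r'}⌋}` steps (`r' ≠ 0`).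

## References

* S. Arora, B. Barak, *Computational Complexity: A Modern Approach*, CUP 2009, §1.3 (machine
  constructions), Def. 2.1 and §2.1.2 (verifier form of nondeterministic time).
* T. Nipkow, G. Klein, *Concrete Semantics with Isabelle/HOL*, Springer 2014, Ch. 7 (big-step
  cost semantics) — the verification style of `SymbolPrograms.lean`.
* V. Kabanets, R. Impagliazzo, *Derandomizing polynomial identity tests means proving circuit
  lower bounds*, STOC 2003, Lemma 3 (p. 357) (the application).
-/

namespace Literature.Computability.Complexity

open _root_.Computability Polynomial

/-- **The root clock length** `c' · 2^{⌊m^{1/r'}⌋} + c' + 1`: the admissible witness length of an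
`NTIME(2^{⌊m^{1/r'}⌋})` verifier with constant `c'`, plus one (a flag symbol). [folklore] -/
def rootClockLen (r' c' m : ℕ) : ℕ := c' * 2 ^ Nat.nthRoot r' m + c' + 1

/-- **The root clock** `rootClock r' c' t = ⟨t, 1^{rootClockLen r' c' |t|}⟩`. [folklore] -/
def rootClock (r' c' : ℕ) (t : List Bool) : List Bool :=
  boolPair t (List.replicate (rootClockLen r' c' t.length) true)

/-- The components of the clock word. [folklore] -/
@[simp] theorem boolUnpair_rootClock (r' c' : ℕ) (t : List Bool) :
    boolUnpair (rootClock r' c' t) = (t, List.replicate (rootClockLen r' c' t.length) true) := by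
  simp [rootClock]

namespace RootClock

open ACom PolyExistsNTIME
open ExpPad (un cPow cExp cExp_eq cPowPoly eval_cPowPoly)

/-! ### The stages -/

/-- `moveNM`: pour the unary length `n` onto `m` (the radicand register of `rootLoop`). [folklore] -/
def moveNM : Prog := loop .n fun _ => push .m true

/-- Effect and cost of `moveNM`: `m := 1^{k} ++ m`, `n := []`. [folklore] -/
theorem runs_moveNM (i xr a b t s e f yr zr o : List Bool) (k μ : ℕ) :
    Runs moveNM (mk i xr (un k) a b t (un μ) s e f yr zr o)
      (mk i xr [] a b t (un (k + μ)) s e f yr zr o) (3 * k + 1) := by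
  have h := runs_loop_inv (k := Rg.n) (f := fun _ => push .m true)
    (fun done rest => mk i xr rest a b t (un (done.length + μ)) s e f yr zr o)
    (fun _ _ => True) 1
    (fun _ _ _ => rfl)
    (fun done c rest _ => ⟨trivial, by
      refine (Runs.push' ?_).of_eq rfl le_rfl
      simp [un, Nat.succ_add, List.replicate_succ]⟩)
    (un k) [] trivial
  unfold moveNM
  simpa [un] using h

/-- `emitB c'`: push `c'` tokens per token of `e`, then `c'` more and one more, on the (empty)
output: `out := 1^{c' |e| + c' + 1}`, consuming `e`. [folklore] -/
def emitB (c' : ℕ) : Prog :=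
  loop .e (fun _ => pushList .out (un c')) ;; pushList .out (un c') ;; push .out true

/-- Effect and cost of `emitB c'`. [folklore] -/
theorem runs_emitB (c' : ℕ) (i xr n a b t m s yr zr : List Bool) (E : ℕ) :
    Runs (emitB c') (mk i xr n a b t m s (un E) [] yr zr [])
      (mk i xr n a b t m s [] [] yr zr (un (c' * E + c' + 1))) ((c' + 2) * E + 1 + c' + 1) := by
  have h1 := runs_loop_inv (k := Rg.e) (f := fun _ => pushList .out (un c'))
    (fun done rest => mk i xr n a b t m s rest [] yr zr (un (c' * done.length)))
    (fun _ _ => True) c'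
    (fun _ _ _ => rfl)
    (fun done a' rest _ => ⟨trivial, by
      have := runs_pushList (Γ := Bool) Rg.out (un c')
        (mk i xr n a b t m s rest [] yr zr (un (c' * done.length)))
      simp only [mk_out, update_mk_out, un, List.reverse_replicate, List.length_replicate,
        List.replicate_append_replicate] at this
      simp only [update_mk_e, List.length_cons, un]
      refine this.of_eq ?_ le_rfl
      rw [Nat.mul_succ, Nat.add_comm]⟩)
    (un E) [] trivial
  have h1' : Runs (loop Rg.e fun _ => pushList Rg.out (un c'))
      (mk i xr n a b t m s (un E) [] yr zr []) (mk i xr n a b t m s [] [] yr zr (un (c' * E)))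
      ((c' + 2) * E + 1) := by
    simpa [un] using h1
  have h2 := runs_pushList (Γ := Bool) Rg.out (un c') (mk i xr n a b t m s [] [] yr zr (un (c' * E)))
  simp only [mk_out, update_mk_out, un, List.reverse_replicate, List.length_replicate,
    List.replicate_append_replicate] at h2
  have h2' : Runs (pushList Rg.out (un c')) (mk i xr n a b t m s [] [] yr zr (un (c' * E)))
      (mk i xr n a b t m s [] [] yr zr (un (c' * E + c'))) c' := by
    refine h2.of_eq ?_ le_rfl
    simp [un, Nat.add_comm]
  have h3 : Runs (push Rg.out true) (mk i xr n a b t m s [] [] yr zr (un (c' * E + c')))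
      (mk i xr n a b t m s [] [] yr zr (un (c' * E + c' + 1))) 1 :=
    Runs.push' (by simp [un_succ])
  unfold emitB
  exact (h1'.seq (h2'.seq h3)).of_eq rfl (by omega)

/-! ### The program -/

/-- **The root clock program**: `t ↦ boolPair t (1^{c' · 2^{⌊|t|^{1/r'}⌋} + c' + 1})` — split the
input into a reversed copy and its unary length, take the integer root of the length,
exponentiate by doubling, emit the clock and then the doubled copy of `t`. [folklore] -/
def prog (r' c' : ℕ) : Prog :=
  split ;; moveNM ;; push .e true ;; rootLoop r' ;; push .e true ;; (loop .s fun _ => dblE) ;;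
  emitB c' ;; emitX ;; clear .m

/-- **Cost of the root clock program** on inputs of length `n`. [folklore] -/
def cost (r' c' n : ℕ) : ℕ :=
  (4 * n + 1) + (3 * n + 1) + 1 + ((n + 2) * (cRootIter r' n + 2) + 1) + 1 +
  cExp (Nat.nthRoot r' n) 1 + ((c' + 2) * 2 ^ Nat.nthRoot r' n + 1 + c' + 1) + (4 * n + 3) + (2 * n + 1)

/-- **Specification of the root clock program** (`r' ≠ 0`): from the input store holding `t` to
the output store holding `rootClock r' c' t`, within `cost r' c' |t|` steps. [folklore] -/
theorem runs_prog {r' : ℕ} (hr' : r' ≠ 0) (c' : ℕ) (t : List Bool) :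
    Runs (prog r' c') (AStore.single .inp t) (AStore.single .out (rootClock r' c' t))
      (cost r' c' t.length) := by
  rw [single_inp, single_out]
  set n := t.length with hn
  have h1 := runs_split t
  rw [← hn] at h1
  have h2 := runs_moveNM [] t.reverse [] [] [] [] [] [] [] [] [] n 0
  simp only [Nat.add_zero] at h2
  have h3 : Runs (push Rg.e true) (mk [] t.reverse [] [] [] [] (un n) [] [] [] [] [] [])
      (mk [] t.reverse [] [] [] [] (un n) [] [true] [] [] [] []) 1 := Runs.push' (by simp)
  have h4 := runs_root hr' [] t.reverse [] [] [] [] [] n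
  set s := Nat.nthRoot r' n with hs
  have h5 : Runs (push Rg.e true) (mk [] t.reverse [] [] [] [] (un n) (un s) [] [] [] [] [])
      (mk [] t.reverse [] [] [] [] (un n) (un s) (un 1) [] [] [] []) 1 :=
    Runs.push' (by simp [un])
  have h6 := runs_exp2 [] t.reverse [] [] [] [] (un n) [] [] [] s 1
  rw [one_mul] at h6
  have h7 := runs_emitB c' [] t.reverse [] [] [] [] (un n) [] [] [] (2 ^ s)
  have h8 := runs_emitX t (un n) (un (c' * 2 ^ s + c' + 1))
  have h9 := runs_clear (Γ := Bool) Rg.m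
    (mk [] [] [] [] [] [] (un n) [] [] [] [] [] (boolPair t (un (c' * 2 ^ s + c' + 1))))
  simp only [mk_m, update_mk_m, un, List.length_replicate] at h9
  have := h1.seq (h2.seq (h3.seq (h4.seq (h5.seq (h6.seq (h7.seq (h8.seq h9)))))))
  unfold prog
  refine this.of_eq ?_ ?_
  · simp [rootClock, rootClockLen, ← hs, ← hn]
  · simp only [cost, ← hs]
    omega

/-! ### The time bound -/

/-- The cost of one root iteration is polynomial in the radicand: `cRootIter r' n` is the value of
`(cPowPoly r').comp (X + 1) + 8 (X + 1)^{r'} + 11`. [folklore] -/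
theorem eval_cRootIterPoly (r' n : ℕ) :
    ((cPowPoly r').comp (X + 1) + Polynomial.C 8 * (X + 1) ^ r' + Polynomial.C 11).eval n =
      cRootIter r' n := by
  simp [cRootIter, eval_cPowPoly]

/-- **The root clock program runs in time `poly(n) + O(2^{⌊n^{1/r'}⌋})`**:
`cost r' c' n + 1 ≤ P(n) + K · 2^{⌊n^{1/r'}⌋}` for a polynomial `P` and a constant `K`. [folklore] -/
theorem exists_cost_le (r' c' : ℕ) :
    ∃ (P : Polynomial ℕ) (K : ℕ), ∀ n : ℕ, cost r' c' n + 1 ≤ P.eval n + K * 2 ^ Nat.nthRoot r' n := by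
  refine ⟨Polynomial.C 13 * X + Polynomial.C (c' + 11) +
      (X + Polynomial.C 2) * ((cPowPoly r').comp (X + 1) + Polynomial.C 8 * (X + 1) ^ r' +
        Polynomial.C 11 + Polynomial.C 2),
    c' + 16, fun n => ?_⟩
  have hexp := cExp_eq (Nat.nthRoot r' n) 1
  set s := Nat.nthRoot r' n with hs
  have hs2 : s ≤ 2 ^ s := Nat.lt_two_pow_self.le
  have h1 : 1 ≤ 2 ^ s := Nat.one_le_two_pow
  simp only [cost, ← hs]
  simp only [eval_add, eval_mul, eval_C, eval_X, eval_comp, eval_pow, eval_one, eval_cPowPoly]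
  have hiter : cRootIter r' n = cPow (n + 1) r' + 8 * (n + 1) ^ r' + 11 := rfl
  rw [hiter]
  nlinarith [hexp, h1, hs2]

end RootClock

/-! ### The clock machine -/

open RootClock in
/-- **The root clock is computed by a multi-stack machine within `cost r' c' |t| + 1` steps**
(the structured program `RootClock.prog r' c'` compiled by `ACom.exists_computesInTime`). [folklore] -/
theorem exists_computesInTime_rootClock {r' : ℕ} (hr' : r' ≠ 0) (c' : ℕ) :
    ∃ M : Turing.TM2ComputableAux Bool Bool,
      ComputesInTime (id : List Bool → List Bool) id (rootClock r' c')
        (fun t => RootClock.cost r' c' t.length + 1) M :=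
  ACom.exists_computesInTime (RootClock.prog r' c') .inp .out id id (rootClock r' c')
    (fun t => RootClock.cost r' c' t.length) (RootClock.runs_prog hr' c')

/-- **The root clock machine**: for `r' ≠ 0` some `TM2` machine maps every `t` to
`rootClock r' c' t = ⟨t, 1^{c' · 2^{⌊|t|^{1/r'}⌋} + c' + 1}⟩` within `P(|t|) + K · 2^{⌊|t|^{1/r'}⌋}`
steps, `P` a polynomial. [cite: AroraBarak2009, §1.3 (machine constructions)] -/
theorem exists_rootClock_machine {r' : ℕ} (hr' : r' ≠ 0) (c' : ℕ) :
    ∃ (P : Polynomial ℕ) (K : ℕ) (N : Turing.TM2ComputableAux Bool Bool), ∀ t : List Bool,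
      N.OutputsWithin t (rootClock r' c' t) (P.eval t.length + K * 2 ^ Nat.nthRoot r' t.length) := by
  obtain ⟨P, K, hPK⟩ := RootClock.exists_cost_le r' c'
  obtain ⟨N, hN⟩ := exists_computesInTime_rootClock hr' c'
  exact ⟨P, K, N, fun t => (hN t).mono (hPK t.length)⟩

end Literature.Computability.Complexity
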